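import Summits.ValiantsHypothesis.ValiantsHypothesis.Theorems.SymPencilPerFourTwoLineFilter
import Summits.ValiantsHypothesis.ValiantsHypothesis.Theorems.SymPencilPerFourPairingDiscSixOnto
import Summits.ValiantsHypothesis.ValiantsHypothesis.Theorems.SymPencilPerFourPairingDiscSixProduct
import Summits.ValiantsHypothesis.ValiantsHypothesis.Theorems.SymPencilPerFourRowPairing
import Summits.ValiantsHypothesis.ValiantsHypothesis.Theorems.SymPencilPerFourLowRankSeven

/-!
# Route `SymPencil` — row `r = 10` of the size-`28` table: the threshold-shifted declarations of
# `SymPencilPerFourTwoLineFilter` (`--supports` stmt-ValiantsHypothesis-5674 `SdcSuperquadratic`; rung currency only)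

The declarations below (suffix `_m28`) are those of the landed `…Theorems.SymPencilPerFourTwoLineFilter` whose meaning
changes when its numerical thresholds move by one unit — `Fin 6 → Fin 7` square families /
`|ι'| ≤ 26 → ≤ 27` / `m ≤ 27 → m ≤ 28`, as applicable — with proofs VERBATIM; unchanged
declarations are used from the original module by name (same namespace).  Why it elaborates
(m = 28 table audit, val-lit-p6 g17, 2026-08-29; reader of record val-idea-crit-5 g4, probe P31):
the leaves of the `(10, 6)` chain are stated for `card ι < 8` / `< 9`, and every size lever reads
`4·rk bL ≤ 2·dim K + |ι'|` through integer division — one unit of slack throughout.  The `_m28`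
statements imply the landed ones.

Honest framing: part of ONE row (cell `(10, 6, 7)`) of the size-`28` table; nothing about
`sdc(per_4)` follows here; `28 ≤ sdc(per_4) ≤ 29` of record, the crux `SdcSuperquadratic` and
`VP ≠ VNP` untouched.  Credit: mathematics and proof text of `SymPencilPerFourTwoLineFilter` (its authors); this file only
moves the bound.  No definitions, no named facts. [folklore]
-/

noncomputable section

-- single-conjunct layout: Sub = Summit, duplicated namespace component intended
set_option linter.dupNamespace false

namespace Summit.ValiantsHypothesis.ValiantsHypothesis.Theorems.SymPencilPerFourTwoLineFilter

open Matrix MvPolynomial Finset Module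
open Literature.Computability.AlgebraicComplexity
open Literature.Computability.AlgebraicComplexity.AlperBogartVelasco
open Summit.ValiantsHypothesis.ValiantsHypothesis.Theorems.SymPencilPerFourPairingDiscSixOnto
open Summit.ValiantsHypothesis.ValiantsHypothesis.Theorems.SymPencilPerFourPairingDiscSixProduct
open Summit.ValiantsHypothesis.ValiantsHypothesis.Theorems.SymPencilPerFourRowPairing

variable {K : Type*} [Field K]

/-! ### The trichotomy on `V' ≤ K⁴ × K⁴` -/

/-! ### Coordinate subspaces of `K^{4×4}` -/

/-! ### The row form -/

/-- **Two rows.**  A `6`-dimensional `W` supported on the rows `a ≠ b`, all of whose elements have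
the swapped property with `≤ 6` squares, is `W_col`-type or `W₂`-type (membership criteria).
[folklore] -/
theorem twoRows_filter_m28 [CharZero K] (W : Submodule K (Fin 4 × Fin 4 → K)) (h6 : finrank K W = 6)
    (a b : Fin 4) (hab : a ≠ b) (hrows : ∀ x ∈ W, ∀ i j : Fin 4, i ≠ a → i ≠ b → x (i, j) = 0)
    (hP : ∀ y ∈ W, ∃ (c : Fin 7 → K) (Λ : Fin 7 → ((Fin 4 × Fin 4 → K) →ₗ[K] K)),
      ∀ u : Fin 4 × Fin 4 → K, ∃ e₀ e₁ : K, ∀ s : K,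
        eval (u + s • y) (perPoly (Fin 4) K) = e₀ + s * e₁ + s ^ 2 * ∑ k, c k * (Λ k u) ^ 2) :
    (∃ m : Fin 4, ∀ x : Fin 4 × Fin 4 → K, x ∈ W ↔
        ((∀ i j : Fin 4, i ≠ a → i ≠ b → x (i, j) = 0) ∧ x (a, m) = 0 ∧ x (b, m) = 0)) ∨
    (∃ m m' : Fin 4, m ≠ m' ∧ ∀ x : Fin 4 × Fin 4 → K, x ∈ W ↔
        ((∀ i j : Fin 4, i ≠ a → i ≠ b → x (i, j) = 0) ∧ x (b, m) = 0 ∧ x (b, m') = 0)) ∨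
    (∃ m m' : Fin 4, m ≠ m' ∧ ∀ x : Fin 4 × Fin 4 → K, x ∈ W ↔
        ((∀ i j : Fin 4, i ≠ b → i ≠ a → x (i, j) = 0) ∧ x (a, m) = 0 ∧ x (a, m') = 0)) := by
  classical
  -- the two rows as a point of `K⁴ × K⁴`
  let φ : (Fin 4 × Fin 4 → K) →ₗ[K] (Fin 4 ⊕ Fin 4 → K) :=
    { toFun := fun x c => Sum.elim (fun i => x (a, i)) (fun i => x (b, i)) c
      map_add' := fun x y => by funext c; rcases c with i | i <;> rfl
      map_smul' := fun t x => by funext c; rcases c with i | i <;> rfl }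
  have hφl : ∀ x i, φ x (Sum.inl i) = x (a, i) := fun _ _ => rfl
  have hφr : ∀ x i, φ x (Sum.inr i) = x (b, i) := fun _ _ => rfl
  set V' : Submodule K (Fin 4 ⊕ Fin 4 → K) := W.map φ with hV'
  have hker : (W ⊓ LinearMap.ker φ : Submodule K _) = ⊥ := by
    refine (Submodule.eq_bot_iff _).2 fun x hx => ?_
    rw [Submodule.mem_inf, LinearMap.mem_ker] at hx
    funext c
    obtain ⟨i, j⟩ := c
    by_cases hia : i = a
    · subst hia; simpa [hφl] using congr_fun hx.2 (Sum.inl j)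
    by_cases hib : i = b
    · subst hib; simpa [hφr] using congr_fun hx.2 (Sum.inr j)
    exact hrows x hx.1 i j hia hib
  have hV'6 : finrank K V' = 6 := by
    have h := finrank_eq_finrank_map_add_finrank_inf_ker W φ
    rw [hker, finrank_bot, add_zero, h6] at h
    rw [hV', ← h]
  have hdisc : ∀ Y ∈ V',
      (∑ j, ∏ i, if i = j then Y (Sum.inl i) else Y (Sum.inr i)) *
        (∑ j, ∏ i, if i = j then Y (Sum.inr i) else Y (Sum.inl i)) =
        4 * ∏ i, Y (Sum.inl i) * Y (Sum.inr i) := by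
    intro Y hY
    rw [hV', Submodule.mem_map] at hY
    obtain ⟨x, hx, rfl⟩ := hY
    have h := pairingDisc_eq_of_sum_sq_swap (ι := Fin 7) (by simp) x (hP x hx) hab
    simpa [hφl, hφr] using h
  have hmemV' : ∀ x ∈ W, φ x ∈ V' := fun x hx => by
    rw [hV']; exact Submodule.mem_map_of_mem hx
  rcases trichotomy V' hV'6 hdisc with ⟨m, hm⟩ | ⟨m, m', hmm, hm⟩ | ⟨m, m', hmm, hm⟩
  · -- `W_col`-type
    left
    refine ⟨m, fun x => ⟨fun hx => ⟨hrows x hx, ?_, ?_⟩, fun hx => ?_⟩⟩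
    · simpa [hφl] using (hm _ (hmemV' x hx)).1
    · simpa [hφr] using (hm _ (hmemV' x hx)).2
    · set T : Finset (Fin 4 × Fin 4) := ({a, b} : Finset (Fin 4)) ×ˢ (Finset.univ.erase m) with hT
      have memT : ∀ c : Fin 4 × Fin 4, c ∈ T ↔ (c.1 = a ∨ c.1 = b) ∧ c.2 ≠ m := fun c => by
        rw [hT, Finset.mem_product, Finset.mem_insert, Finset.mem_singleton, Finset.mem_erase]
        simp only [Finset.mem_univ, and_true]
      have hTc : T.card = 6 := by
        rw [hT, Finset.card_product, Finset.card_pair hab, Finset.card_erase_of_mem (Finset.mem_univ m),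
          Finset.card_univ, Fintype.card_fin]
      refine mem_of_support_subset W h6 T hTc (fun y hy c hc => ?_) x (fun c hc => ?_)
      · rw [memT] at hc
        obtain ⟨i, j⟩ := c
        by_cases hia : i = a
        · subst hia
          have hj : j = m := by simpa using hc
          rw [hj]; simpa [hφl] using (hm _ (hmemV' y hy)).1
        by_cases hib : i = b
        · subst hib
          have hj : j = m := by simpa [hia] using hc
          rw [hj]; simpa [hφr] using (hm _ (hmemV' y hy)).2
        exact hrows y hy i j hia hib
      · rw [memT] at hc
        obtain ⟨i, j⟩ := c
        by_cases hia : i = a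
        · subst hia
          have hj : j = m := by simpa using hc
          rw [hj]; exact hx.2.1
        by_cases hib : i = b
        · subst hib
          have hj : j = m := by simpa [hia] using hc
          rw [hj]; exact hx.2.2
        exact hx.1 i j hia hib
  · -- `W₂`-type, row `b` in the coordinate plane
    right; left
    refine ⟨m, m', hmm, fun x => ⟨fun hx => ⟨hrows x hx, ?_, ?_⟩, fun hx => ?_⟩⟩
    · simpa [hφr] using (hm _ (hmemV' x hx)).1
    · simpa [hφr] using (hm _ (hmemV' x hx)).2
    · set T : Finset (Fin 4 × Fin 4) :=
        ({a} : Finset (Fin 4)) ×ˢ Finset.univ ∪ ({b} : Finset (Fin 4)) ×ˢ ((Finset.univ.erase m).erase m')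
        with hT
      have memT : ∀ c : Fin 4 × Fin 4, c ∈ T ↔ c.1 = a ∨ (c.1 = b ∧ c.2 ≠ m' ∧ c.2 ≠ m) := fun c => by
        rw [hT, Finset.mem_union, Finset.mem_product, Finset.mem_product, Finset.mem_singleton,
          Finset.mem_singleton, Finset.mem_erase, Finset.mem_erase]
        simp only [Finset.mem_univ, and_true]
      have hTc : T.card = 6 := by
        rw [hT, Finset.card_union_of_disjoint, Finset.card_product, Finset.card_product,
          Finset.card_singleton, Finset.card_singleton, Finset.card_univ, Fintype.card_fin,
          Finset.card_erase_of_mem (Finset.mem_erase.2 ⟨hmm.symm, Finset.mem_univ _⟩),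
          Finset.card_erase_of_mem (Finset.mem_univ _), Finset.card_univ, Fintype.card_fin]
        rw [Finset.disjoint_left]
        intro c hc1 hc2
        rw [Finset.mem_product, Finset.mem_singleton] at hc1 hc2
        exact hab (hc1.1.symm.trans hc2.1)
      refine mem_of_support_subset W h6 T hTc (fun y hy c hc => ?_) x (fun c hc => ?_)
      · rw [memT] at hc
        obtain ⟨i, j⟩ := c
        by_cases hia : i = a
        · exact absurd (Or.inl hia) hc
        by_cases hib : i = b
        · subst hib
          have hj : j = m' ∨ j = m := by
            by_contra hn; push Not at hn; exact hc (Or.inr ⟨rfl, hn.1, hn.2⟩)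
          rcases hj with rfl | rfl
          · simpa [hφr] using (hm _ (hmemV' y hy)).2
          · simpa [hφr] using (hm _ (hmemV' y hy)).1
        exact hrows y hy i j hia hib
      · rw [memT] at hc
        obtain ⟨i, j⟩ := c
        by_cases hia : i = a
        · exact absurd (Or.inl hia) hc
        by_cases hib : i = b
        · subst hib
          have hj : j = m' ∨ j = m := by
            by_contra hn; push Not at hn; exact hc (Or.inr ⟨rfl, hn.1, hn.2⟩)
          rcases hj with rfl | rfl
          · exact hx.2.2
          · exact hx.2.1
        exact hx.1 i j hia hib
  · -- `W₂`-type, row `a` in the coordinate plane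
    right; right
    refine ⟨m, m', hmm, fun x => ⟨fun hx => ⟨fun i j hib hia => hrows x hx i j hia hib, ?_, ?_⟩,
      fun hx => ?_⟩⟩
    · simpa [hφl] using (hm _ (hmemV' x hx)).1
    · simpa [hφl] using (hm _ (hmemV' x hx)).2
    · set T : Finset (Fin 4 × Fin 4) :=
        ({b} : Finset (Fin 4)) ×ˢ Finset.univ ∪ ({a} : Finset (Fin 4)) ×ˢ ((Finset.univ.erase m).erase m')
        with hT
      have memT : ∀ c : Fin 4 × Fin 4, c ∈ T ↔ c.1 = b ∨ (c.1 = a ∧ c.2 ≠ m' ∧ c.2 ≠ m) := fun c => by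
        rw [hT, Finset.mem_union, Finset.mem_product, Finset.mem_product, Finset.mem_singleton,
          Finset.mem_singleton, Finset.mem_erase, Finset.mem_erase]
        simp only [Finset.mem_univ, and_true]
      have hTc : T.card = 6 := by
        rw [hT, Finset.card_union_of_disjoint, Finset.card_product, Finset.card_product,
          Finset.card_singleton, Finset.card_singleton, Finset.card_univ, Fintype.card_fin,
          Finset.card_erase_of_mem (Finset.mem_erase.2 ⟨hmm.symm, Finset.mem_univ _⟩),
          Finset.card_erase_of_mem (Finset.mem_univ _), Finset.card_univ, Fintype.card_fin]
        rw [Finset.disjoint_left]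
        intro c hc1 hc2
        rw [Finset.mem_product, Finset.mem_singleton] at hc1 hc2
        exact hab (hc2.1.symm.trans hc1.1)
      refine mem_of_support_subset W h6 T hTc (fun y hy c hc => ?_) x (fun c hc => ?_)
      · rw [memT] at hc
        obtain ⟨i, j⟩ := c
        by_cases hib : i = b
        · exact absurd (Or.inl hib) hc
        by_cases hia : i = a
        · subst hia
          have hj : j = m' ∨ j = m := by
            by_contra hn; push Not at hn; exact hc (Or.inr ⟨rfl, hn.1, hn.2⟩)
          rcases hj with rfl | rfl
          · simpa [hφl] using (hm _ (hmemV' y hy)).2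
          · simpa [hφl] using (hm _ (hmemV' y hy)).1
        exact hrows y hy i j hia hib
      · rw [memT] at hc
        obtain ⟨i, j⟩ := c
        by_cases hib : i = b
        · exact absurd (Or.inl hib) hc
        by_cases hia : i = a
        · subst hia
          have hj : j = m' ∨ j = m := by
            by_contra hn; push Not at hn; exact hc (Or.inr ⟨rfl, hn.1, hn.2⟩)
          rcases hj with rfl | rfl
          · exact hx.2.2
          · exact hx.2.1
        exact hx.1 i j hib hia
end Summit.ValiantsHypothesis.ValiantsHypothesis.Theorems.SymPencilPerFourTwoLineFilter

end
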